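import Summits.BirchSwinnertonDyer.BirchSwinnertonDyer.Theorems.AlignedTransportAtTwoMainConjectureOfRankZeroBSDAtTwoFineRoadRealKummerClassical
import Summits.BirchSwinnertonDyer.Rank1Residual.X2.GreenbergVatsalStrictAtP
import Literature.NumberTheory.EllipticCurves.HeegnerPointsKolyvaginCebotarevProofs
import HarnessLib

/-!
# The condition ABOVE `2` in `E[2]`-currency: pulled back along `ι_* : H¹(·, E[2]) → H¹(·, E[2^∞])`, GREENBERG's ordinary condition
# for the datum `C₂ = ker(E[2^∞] → Ẽ)` is EXACTLY «`y mod C₂[2]` is UNRAMIFIED» — the line `C₂[2] = Ê[2] ⊂ E[2]` (the `2`-ADIC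
# letter: the `2`-torsion point in the kernel of reduction); so stub T's conclusion has an `E[2]`-Selmer form with a LINE at `2`
# and a LINE at `∞` (sufficiency in the kernel; equivalence modulo the printed `im κ_𝔭 ⊇ L_𝔭`)

Cell `bsd-f1-sign2`, WIDTH-5 attach seat `bsd-line-att-p5` (gen 10) on line `birth` of crux C2 stmt-BirchSwinnertonDyer-22298
`MainConjectureOfRankZeroBSDAtTwo`; sequel of `…FineRoadRealKummerClassical` (att-p5 g10). A `--supports 22298 --as helper` file.
HONEST FRAMING: THEOREMS ONLY — no definition, no named fact, no `sorry`; C2-NEUTRAL (stub T stays OPEN; the verdict «blocked-on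
GreenbergMuConjectureIrreducible» is untouched); BSD is NOT proved by any of this. The cell's question «what is the ± object at 2» in
2-DESCENT currency: at BOTH critical places the local condition on `E[2]`-classes is cut out by a distinguished `2`-torsion point —
at `2` the point `T₂ ∈ C₂[2]` of the formal group (`v₂(x) < 0`, cell `bsd-2adic`'s `Greenberg1999.TwoTorsionLines`), at `∞` the leftmost
real point `T_∞ = T_min` (att-p5 g9 `RealKummerLetter`): «`y mod T₂` unramified at `2`», «`y(c) ∈ {O, T_∞}` at `∞`».

* §1 (any number field, any datum `N` at `v` whose quotient `M/M⁺_v` is fixed by INERTIA modulo `M⁺_v`): `oneCocycleClass_mem_greenbergKer_iff_forall_mem`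
  (Greenberg's inertia-form condition = «the cocycle takes values in `M⁺_v` on `H ⊓ I_v`»); **`resH1Hom_id_mem_greenbergKer_iff`**: for an
  equivariant `φ : M → M′` and data `N`, `N′` with `N.plus = φ⁻¹(N′.plus)` and inertia trivial on `M′/N′.plus`, `φ_* y ∈ N′.greenbergKer ⟺
  y ∈ N.greenbergKer` — NO divisibility needed (for the inertia-form condition coboundaries vanish; contrast the strict / decomposition
  form, where Frobenius acts).
* §2 (`E/ℚ` globally minimal, good prime `p`, X2's `reductionDatum W p` = Greenberg's `C_p`, `reductionDatum_htriv`): **`exists_torsionDatum`**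
  (a datum for `E[p]` at `v ∋ p` with `plus = C_p ∩ E[p] = C_p[p]`) and **`torsionToPrimaryH1Sub_mem_greenbergKer_iff`**
  (`ι_* y ∈ C_p.greenbergKer ⟺ y ∈ C_p[p].greenbergKer`, every such datum).
* §3 (`ℚ`, `p = 2`, cyclotomic, `Δ_E > 0`, `2 ∤ Δ_min`): with `Q` of `RealKummerClassical` (odd places: locally trivial; above `2`: classical
  Kummer pulled back; `∞`: Kummer line) and `Q_Gr` (above `2`: `y mod C₂[2]` unramified, i.e. `conj_σ y ∈ C₂[2].greenbergKer`):
  **`comap_selmerInfty_inf_away_le`** (`Q ≤ Q_Gr`, kernel: X2 `GreenbergVatsalSelmerLink.localKerOver_le_greenbergKer`), hence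
  **`finite_twoTorsion_selmerInfty_of_finite`** — SUFFICIENCY: if the explicit `E[2]`-Selmer group `Q_Gr` over `ℚ_∞` is finite then
  `Sel_{2^∞}(W/ℚ_∞)[2]` is finite (= `X` torsion with `μ₂ = 0`, stub T's conclusion, att-p3 g7); and modulo the printed
  `GreenbergVatsal2000.imKummer_ge_greenbergCondition_at_p` + `2 ∤ a₂` (X2 `localKerOver_eq_greenbergKer_and_strictKer`):
  **`comap_selmerInfty_inf_away_eq_of_GV`**, **`finite_twoTorsion_selmerInfty_iff_of_GV`** (`Q = Q_Gr`, IFF).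

References: R. Greenberg, LNM 1716 (1999) §2 pp. 69–75 (C_v, Props. 2.1–2.4), §5 pp. 168–176; R. Greenberg, V. Vatsal, Invent. Math. 142
(2000) §2 pp. 16, 26; R. Greenberg, Adv. Stud. Pure Math. 17 (1989) p. 98; J.-P. Serre, *Galois Cohomology* I §2.3–2.5; crux workfiles
`PERFECT-DESCENT.md`, `RELAXED-COEFFICIENTS-att-p5.md` (cell bsd-f1-sign2).
-/

set_option autoImplicit false
-- the Theorems namespace of this sub repeats the summit name by design (D-0017 nested layout)
set_option linter.dupNamespace false

noncomputable section

open scoped Classical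

namespace Summit.BirchSwinnertonDyer.BirchSwinnertonDyer.Theorems.AlignedTransportAtTwoFineRoad.RealKummerOrdinary

open WeierstrassCurve NumberField IsDedekindDomain Field Literature.NumberTheory.EllipticCurves
  Literature.NumberTheory.EllipticCurves.GreenbergSelmer Literature.NumberTheory.GaloisRepresentations
  Literature.NumberTheory.EllipticCurves.FineSelmerCoefficientMap
  Summit.BirchSwinnertonDyer.BirchSwinnertonDyer.Theorems.AlignedTransportAtTwoFineRoad
  Summit.BirchSwinnertonDyer.Rank1Residual.X2 Summit.BirchSwinnertonDyer.Rank1Residual.X2.GreenbergVatsalReductionDatum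

/-! ## §1 Greenberg's inertia-form condition under a change of coefficients, when inertia acts trivially on the quotient -/

section Generic

variable {K : Type} [Field K] [NumberField K] (H : Subgroup (absoluteGaloisGroup K))
  {M : Type} [AddCommGroup M] [DistribMulAction (absoluteGaloisGroup K) M] [TopologicalSpace M] [DiscreteTopology M]
  {M' : Type} [AddCommGroup M'] [DistribMulAction (absoluteGaloisGroup K) M'] [TopologicalSpace M'] [DiscreteTopology M']
  {v : HeightOneSpectrum (𝓞 K)}

/-- **Greenberg's condition = «values in `M⁺_v` on `H ⊓ I_v`»** when the inertia group fixes `M/M⁺_v` pointwise (`x • m − m ∈ M⁺_v`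
for `x ∈ I_v`): then `H¹(H ⊓ I_v, M/M⁺_v)` has no non-zero coboundaries and the class of a cocycle `f` lies in `N.greenbergKer H` iff
`f(H ⊓ I_v) ⊆ M⁺_v`. [cite: Greenberg1989, §1 p. 98 (4)] [cite: GreenbergLNM1716, §2 p. 73 («E[p^∞]/C_v is unramified»)] -/
theorem oneCocycleClass_mem_greenbergKer_iff_forall_mem (N : LocalDatum K M v)
    (htriv : ∀ x ∈ inertia v, ∀ m : M, x • m - m ∈ N.plus) (f : contOneCocycles (discreteTopRep H M)) :
    oneCocycleClass (discreteTopRep H M) f ∈ N.greenbergKer H ↔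
      ∀ x : inertiaIn H v, f.1 (inertiaInToH H v x) ∈ N.plus := by
  refine ⟨fun h x ↦ ?_, GreenbergVatsalSelmerLink.oneCocycleClass_mem_greenbergKer_of_forall_mem H M N f⟩
  obtain ⟨q, hq⟩ := (GreenbergVatsalSelmerLink.oneCocycleClass_mem_greenbergKer_iff H M N f).1 h
  obtain ⟨m, rfl⟩ := N.grMk_surjective q
  have hx : ((x : decomp (K := K) v) : absoluteGaloisGroup K) ∈ inertia v := ((mem_inertiaIn_iff H v x).1 x.2).2
  have h1 := hq x
  rw [Subgroup.smul_def, N.smul_grMk, ← map_sub] at h1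
  -- `x • m - m ∈ M⁺`, so `f(x) ∈ M⁺`
  have h2 : f.1 (inertiaInToH H v x) - ((((x : decomp (K := K) v) : absoluteGaloisGroup K) • m) - m) ∈ N.plus := by
    rw [← N.ker_grMk, AddMonoidHom.mem_ker, map_sub, h1, sub_self]
  have h3 := N.plus.add_mem h2 (htriv _ hx m)
  rwa [sub_add_cancel] at h3

/-- **Change of coefficients for Greenberg's condition (inertia form).** For a `Γ_K`-equivariant `φ : M → M′`, data `N` on `M` and `N′`
on `M′` at `v` with `N.plus = φ⁻¹(N′.plus)`, and inertia fixing `M′/N′.plus` pointwise: `φ_* y ∈ N′.greenbergKer H ⟺ y ∈ N.greenbergKer H`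
for every `y ∈ H¹(H, M)` — with NO divisibility or injectivity hypothesis (the condition on either side is «cocycle values in `M⁺` on
`H ⊓ I_v`», and `f(x) ∈ N.plus ⟺ φ(f(x)) ∈ N′.plus`). [cite: Greenberg1989, §1 p. 98 (4)] [cite: GreenbergLNM1716, §2 pp. 70–73] -/
theorem resH1Hom_id_mem_greenbergKer_iff (φ : M →+ M') (hφ : ∀ (g : absoluteGaloisGroup K) (m : M), φ (g • m) = g • φ m)
    (hφ' : ∀ (x : H) (m : M), φ (ContinuousMonoidHom.id H x • m) = x • φ m)
    (N : LocalDatum K M v) (N' : LocalDatum K M' v) (hplus : ∀ m : M, m ∈ N.plus ↔ φ m ∈ N'.plus)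
    (htriv' : ∀ x ∈ inertia v, ∀ m' : M', x • m' - m' ∈ N'.plus) (y : subgroupH1 H M) :
    resH1Hom (ContinuousMonoidHom.id H) φ hφ' y ∈ N'.greenbergKer H ↔ y ∈ N.greenbergKer H := by
  have htriv : ∀ x ∈ inertia v, ∀ m : M, x • m - m ∈ N.plus := fun x hx m ↦ by
    rw [hplus, map_sub, hφ]
    exact htriv' x hx (φ m)
  obtain ⟨f, rfl⟩ := oneCocycleClass_surjective _ y
  rw [resH1Hom_oneCocycleClass, oneCocycleClass_mem_greenbergKer_iff_forall_mem H N' htriv',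
    oneCocycleClass_mem_greenbergKer_iff_forall_mem H N htriv]
  refine forall_congr' fun x ↦ ?_
  rw [pullback_resHomOfEquivariant_apply, ← hplus]
  rfl

end Generic

/-! ## §2 `E[p] ↪ E[p^∞]` at a good prime `p` of a globally minimal `E/ℚ`: Greenberg's datum `C_p` and its `p`-torsion `C_p[p]` -/

section Torsion

variable (W : WeierstrassCurve ℚ) [W.IsGloballyMinimal] [W.IsElliptic] (p : ℕ) [Fact p.Prime]
  {v : HeightOneSpectrum (𝓞 ℚ)}

omit [W.IsElliptic] in
/-- **A Greenberg datum for `E[p]` at `v ∋ p` with `plus = C_p ∩ E[p] = C_p[p]`** (the `p`-torsion of the kernel of reduction; for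
`p = 2` good ordinary: the line spanned by the `2`-torsion point of the formal group, `v₂(x) < 0`) EXISTS — `D_v`-stability is inherited
from X2's `reductionDatum`. (A term built in the proof; no definition is introduced.) [cite: GreenbergLNM1716, §2 p. 70 and §5 p. 168] -/
theorem exists_torsionDatum (hpv : ((p : ℕ) : 𝓞 ℚ) ∈ v.asIdeal) (hΔ : ¬ (p : ℤ) ∣ minimalDiscriminantInt W) :
    ∃ N : LocalDatum ℚ ↥(W.geomTorsion (p : ℤ)) v, ∀ t : ↥(W.geomTorsion (p : ℤ)),
      t ∈ N.plus ↔ AddSubgroup.inclusion (geomTorsion_le_geomPrimaryTorsion W p) t ∈ (reductionDatum W p hpv hΔ).plus :=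
  ⟨{ plus := (reductionDatum W p hpv hΔ).plus.comap (AddSubgroup.inclusion (geomTorsion_le_geomPrimaryTorsion W p))
     smul_mem := fun σ m hm ↦ by
       rw [AddSubgroup.mem_comap] at hm ⊢
       exact (reductionDatum W p hpv hΔ).smul_mem σ hm }, fun _ ↦ Iff.rfl⟩

omit [W.IsElliptic] in
/-- **`ι_* y ∈ C_p.greenbergKer ⟺ y ∈ C_p[p].greenbergKer`** for every subgroup `H ≤ Γ_ℚ`, every `y ∈ H¹(H, E[p])` and every datum on
`E[p]` with `plus = C_p ∩ E[p]`: pulled back to `E[p]`-classes, Greenberg's condition at a good prime `p` (datum `C_p = ker(E[p^∞] → Ẽ)`,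
inertia acts trivially on `E[p^∞]/C_p` — X2 `reductionDatum_htriv`) is Greenberg's condition for the sub-datum `C_p[p]`, EXACTLY: «the
restriction of `y mod C_p[p]` to the inertia group `H ⊓ I_v` is zero». [cite: GreenbergLNM1716, §2 pp. 70–73] [cite: Greenberg1989, §1 p. 98 (4)] -/
theorem torsionToPrimaryH1Sub_mem_greenbergKer_iff (hpv : ((p : ℕ) : 𝓞 ℚ) ∈ v.asIdeal) (hΔ : ¬ (p : ℤ) ∣ minimalDiscriminantInt W)
    (H : Subgroup (absoluteGaloisGroup ℚ)) (N : LocalDatum ℚ ↥(W.geomTorsion (p : ℤ)) v)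
    (hN : ∀ t : ↥(W.geomTorsion (p : ℤ)),
      t ∈ N.plus ↔ AddSubgroup.inclusion (geomTorsion_le_geomPrimaryTorsion W p) t ∈ (reductionDatum W p hpv hΔ).plus)
    (y : subgroupH1 H ↥(W.geomTorsion (p : ℤ))) :
    W.torsionToPrimaryH1Sub p H y ∈ (reductionDatum W p hpv hΔ).greenbergKer H ↔ y ∈ N.greenbergKer H :=
  resH1Hom_id_mem_greenbergKer_iff H (AddSubgroup.inclusion (geomTorsion_le_geomPrimaryTorsion W p)) (fun _ _ ↦ rfl)
    (fun _ _ ↦ rfl) N (reductionDatum W p hpv hΔ) hN (reductionDatum_htriv W p hpv hΔ) y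

end Torsion

/-! ## §3 `E/ℚ`, `p = 2`, `Δ_E > 0`, good (ordinary) `2`: `Q ≤ Q_Gr` in the kernel; `Q = Q_Gr` modulo the printed `im κ_𝔭 ⊇ L_𝔭` -/

section RatTwo

variable (W : WeierstrassCurve ℚ) [W.IsGloballyMinimal] [W.IsElliptic] (κ : ZpExtension ℚ 2)
  {v : HeightOneSpectrum (𝓞 ℚ)}

omit [W.IsElliptic] in
/-- **`Q ≤ Q_Gr` (kernel, unconditional):** every class of `ι_*⁻¹(Sel_{2^∞}(W/ℚ_∞))` satisfies, at the place `v ∋ 2` and every conjugate,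
Greenberg's condition for `C₂[2]` — «`conj_σ y mod C₂[2]` is unramified» (X2 `GreenbergVatsalSelmerLink.localKerOver_le_greenbergKer` with
`reductionDatum_kummer`: Kummer ⊆ Greenberg at a good prime, then §2). [cite: GreenbergLNM1716, §2 pp. 69–70 (Sel_E ⊆ S_A)] -/
theorem mem_greenbergKer_of_mem_comap_selmerInfty (hpv : ((2 : ℕ) : 𝓞 ℚ) ∈ v.asIdeal) (hΔ : ¬ (2 : ℤ) ∣ minimalDiscriminantInt W)
    (N : LocalDatum ℚ ↥(W.geomTorsion ((2 : ℕ) : ℤ)) v)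
    (hN : ∀ t : ↥(W.geomTorsion ((2 : ℕ) : ℤ)),
      t ∈ N.plus ↔ AddSubgroup.inclusion (geomTorsion_le_geomPrimaryTorsion W 2) t ∈ (reductionDatum W 2 hpv hΔ).plus)
    {y : subgroupH1 κ.kerSubgroup ↥(W.geomTorsion ((2 : ℕ) : ℤ))}
    (hy : y ∈ (W.selmerInfty κ).comap (W.torsionToPrimaryH1Sub 2 κ.kerSubgroup)) (σ : absoluteGaloisGroup ℚ) :
    conjH1 κ.kerSubgroup (↥(W.geomTorsion ((2 : ℕ) : ℤ))) σ y ∈ N.greenbergKer κ.kerSubgroup := by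
  rw [← torsionToPrimaryH1Sub_mem_greenbergKer_iff W 2 hpv hΔ κ.kerSubgroup N hN, ← WeierstrassCurve.conjH1_torsionToPrimaryH1Sub]
  have hy' : W.torsionToPrimaryH1Sub 2 κ.kerSubgroup y ∈ W.selmerInfty κ := hy
  rw [WeierstrassCurve.selmerInfty, WeierstrassCurve.mem_selmerGroupOver_iff] at hy'
  exact GreenbergVatsalSelmerLink.localKerOver_le_greenbergKer W 2 κ.kerSubgroup (reductionDatum W 2 hpv hΔ)
    (reductionDatum_kummer W 2 hpv hΔ) (hy'.1 v σ)

/-- **SUFFICIENCY, in the kernel: if the explicit `E[2]`-Selmer group `Q_Gr` over `ℚ_∞` is finite, then `Sel_{2^∞}(W/ℚ_∞)[2]` is finite**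
(equivalently `X(W/ℚ_∞)` is `Λ`-torsion with `μ₂ = 0` — stub T's conclusion, att-p3 g7 `SeedTwoTorsion`). Here `Δ_E > 0`, `2 ∤ Δ_min`,
`κ` cyclotomic, `g ∈ ker κ ⊓ D_w` non-trivial fixing `E[2]`, `T_w` its Kummer letter, `N` any datum with `plus = C₂[2]`, and
`Q_Gr = {y ∈ H¹(ℚ_∞, E[2]) | (i) conj_σ y|_{ker κ ⊓ D_v} = 0 for every ODD v, σ; (ii) conj_σ y ∈ C₂[2].greenbergKer for every σ (UNRAMIFIED
modulo the 2-adic letter); (iii) ev_w(conj_σ y) ∈ {O, T_w} for every σ (the KUMMER LINE of the real letter)}` — a LINE at `2`, a LINE at `∞`.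
[cite: GreenbergLNM1716, §1 Conj. 1.11, §2 pp. 69–75, §4 Lemma 4.6, §5 p. 168] [cite: Washington1997, §13.2] -/
theorem finite_twoTorsion_selmerInfty_of_finite (hκ : κ.IsCyclotomic) (hΔpos : 0 < W.Δ)
    (hpv : ((2 : ℕ) : 𝓞 ℚ) ∈ v.asIdeal) (hΔ : ¬ (2 : ℤ) ∣ minimalDiscriminantInt W)
    (N : LocalDatum ℚ ↥(W.geomTorsion ((2 : ℕ) : ℤ)) v)
    (hN : ∀ t : ↥(W.geomTorsion ((2 : ℕ) : ℤ)),
      t ∈ N.plus ↔ AddSubgroup.inclusion (geomTorsion_le_geomPrimaryTorsion W 2) t ∈ (reductionDatum W 2 hpv hΔ).plus)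
    (w : InfinitePlace ℚ) (htriv : ∀ (g : ↥(κ.kerSubgroup ⊓ decompInf w)) (m : ↥(W.geomTorsion 2)), g • m = m)
    {g : ↥(κ.kerSubgroup ⊓ decompInf w)} (hg : g ≠ 1) {Tw : ↥(W.geomTorsion 2)}
    (hline : ∀ t : ↥(W.geomTorsion 2),
      (∃ a : ↥(W.geomPrimaryTorsion 2), (g : absoluteGaloisGroup ℚ) • a - a =
          AddSubgroup.inclusion (geomTorsion_le_geomPrimaryTorsion W 2) t) ↔ (t = 0 ∨ t = Tw))
    (hfin : Set.Finite {y : subgroupH1 κ.kerSubgroup ↥(W.geomTorsion 2) |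
      (∀ (u : HeightOneSpectrum (𝓞 ℚ)), ((2 : ℕ) : 𝓞 ℚ) ∉ u.asIdeal → ∀ σ : absoluteGaloisGroup ℚ,
          resOfLe (↥(W.geomTorsion 2)) (inf_le_left : κ.kerSubgroup ⊓ decomp u ≤ κ.kerSubgroup)
            (conjH1 κ.kerSubgroup (↥(W.geomTorsion 2)) σ y) = 0) ∧
        (∀ σ : absoluteGaloisGroup ℚ, conjH1 κ.kerSubgroup (↥(W.geomTorsion ((2 : ℕ) : ℤ))) σ y ∈ N.greenbergKer κ.kerSubgroup) ∧
        ∀ σ : absoluteGaloisGroup ℚ,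
          evalH1 htriv g (resOfLe (↥(W.geomTorsion 2)) (inf_le_left : κ.kerSubgroup ⊓ decompInf w ≤ κ.kerSubgroup)
              (conjH1 κ.kerSubgroup (↥(W.geomTorsion 2)) σ y)) = 0 ∨
            evalH1 htriv g (resOfLe (↥(W.geomTorsion 2)) (inf_le_left : κ.kerSubgroup ⊓ decompInf w ≤ κ.kerSubgroup)
              (conjH1 κ.kerSubgroup (↥(W.geomTorsion 2)) σ y)) = Tw}) :
    Set.Finite {s : W.selmerInfty κ | 2 • s = 0} := by
  obtain ⟨Tw', hTw0', hline', hiff⟩ := RealKummerClassical.exists_kummerLetter_mem_comap_selmerInfty_inf_away_iff W κ hΔpos w htriv hg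
  -- the two Kummer letters coincide
  have hTw : Tw' = Tw := by
    rcases (hline Tw').1 ((hline' Tw').2 (Or.inr rfl)) with h | h
    · exact absurd h hTw0'
    · exact h
  subst hTw
  rw [RealKummerClassical.finite_pTorsion_selmerInfty_iff_finite_comap_inf_away W κ hκ (p := 2)]
  refine hfin.subset fun y hy ↦ ?_
  have hy' := (hiff y).1 hy
  refine ⟨hy'.1, fun σ ↦ mem_greenbergKer_of_mem_comap_selmerInfty W κ hpv hΔ N hN hy.1 σ, hy'.2.2⟩

/-- **`Q = Q_Gr` modulo the printed `im κ_𝔭 ⊇ L_𝔭`** (`GreenbergVatsal2000.imKummer_ge_greenbergCondition_at_p`, hypothesis `hGV`) at a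
good ORDINARY `2` (`2 ∤ Δ_min`, `2 ∤ a₂`), cyclotomic `κ`: above `2` the pulled-back classical Kummer condition IS «`y mod C₂[2]` unramified»
(X2 `GreenbergVatsalStrictAtP.localKerOver_eq_greenbergKer_and_strictKer` + §2). [cite: GreenbergLNM1716, §2 Props. 2.2, 2.4 (pp. 73–75)]
[cite: GreenbergVatsal2000, §2 p. 26] -/
theorem torsionToPrimaryH1Sub_mem_localKerOver_iff_of_GV
    (hGV : Literature.NumberTheory.EllipticCurves.GreenbergVatsal2000.imKummer_ge_greenbergCondition_at_p)
    (hκ : κ.IsCyclotomic) (hpv : ((2 : ℕ) : 𝓞 ℚ) ∈ v.asIdeal) (hΔ : ¬ (2 : ℤ) ∣ minimalDiscriminantInt W)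
    (hord : ¬ (2 : ℤ) ∣ W.frobeniusTrace 2) (N : LocalDatum ℚ ↥(W.geomTorsion ((2 : ℕ) : ℤ)) v)
    (hN : ∀ t : ↥(W.geomTorsion ((2 : ℕ) : ℤ)),
      t ∈ N.plus ↔ AddSubgroup.inclusion (geomTorsion_le_geomPrimaryTorsion W 2) t ∈ (reductionDatum W 2 hpv hΔ).plus)
    (y : subgroupH1 κ.kerSubgroup ↥(W.geomTorsion ((2 : ℕ) : ℤ))) :
    W.torsionToPrimaryH1Sub 2 κ.kerSubgroup y ∈ W.localKerOver 2 κ.kerSubgroup (v.adicCompletion ℚ) ↔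
      y ∈ N.greenbergKer κ.kerSubgroup := by
  rw [(GreenbergVatsalStrictAtP.localKerOver_eq_greenbergKer_and_strictKer W 2 κ hGV hκ hpv hΔ hord).1]
  exact torsionToPrimaryH1Sub_mem_greenbergKer_iff W 2 hpv hΔ κ.kerSubgroup N hN y

/-- **THE `E[2]`-SELMER FORM OF STUB T's CONCLUSION, WITH A LINE AT `2` AND A LINE AT `∞`** (modulo the printed `im κ_𝔭 ⊇ L_𝔭`):
for `E/ℚ` globally minimal, good ordinary at `2`, `Δ_E > 0`, cyclotomic `ℤ₂`-extension, `Sel_{2^∞}(W/ℚ_∞)[2]` is finite — i.e. `X(W/ℚ_∞)` is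
`Λ`-torsion with `μ₂ = 0` — IFF the set `Q_Gr` of classes `y ∈ H¹(ℚ_∞, E[2])` that are (i) locally trivial at every ODD place-conjugate,
(ii) UNRAMIFIED MODULO THE 2-ADIC LETTER `C₂[2]` at the place above `2` (every conjugate), (iii) on the KUMMER LINE of the real letter at
every real place-conjugate, is finite. The forward half of the local identification at `2` is printed (Greenberg LNM 1716 Props. 2.2/2.4
via GV 2000 p. 26, hypothesis `hGV`); without it §3 gives the sufficiency `Q_Gr finite ⟹ T-conclusion` in the kernel.
[cite: GreenbergLNM1716, §1 Conj. 1.11, §2 Props. 2.2–2.4, §4 Lemma 4.6, §5 p. 168] [cite: GreenbergVatsal2000, §2 p. 26] -/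
theorem finite_twoTorsion_selmerInfty_iff_of_GV
    (hGV : Literature.NumberTheory.EllipticCurves.GreenbergVatsal2000.imKummer_ge_greenbergCondition_at_p)
    (hκ : κ.IsCyclotomic) (hΔpos : 0 < W.Δ) (hpv : ((2 : ℕ) : 𝓞 ℚ) ∈ v.asIdeal) (hΔ : ¬ (2 : ℤ) ∣ minimalDiscriminantInt W)
    (hord : ¬ (2 : ℤ) ∣ W.frobeniusTrace 2) (N : LocalDatum ℚ ↥(W.geomTorsion ((2 : ℕ) : ℤ)) v)
    (hN : ∀ t : ↥(W.geomTorsion ((2 : ℕ) : ℤ)),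
      t ∈ N.plus ↔ AddSubgroup.inclusion (geomTorsion_le_geomPrimaryTorsion W 2) t ∈ (reductionDatum W 2 hpv hΔ).plus)
    (w : InfinitePlace ℚ) (htriv : ∀ (g : ↥(κ.kerSubgroup ⊓ decompInf w)) (m : ↥(W.geomTorsion 2)), g • m = m)
    {g : ↥(κ.kerSubgroup ⊓ decompInf w)} (hg : g ≠ 1) :
    ∃ Tw : ↥(W.geomTorsion 2), Tw ≠ 0 ∧
      (∀ t : ↥(W.geomTorsion 2),
        (∃ a : ↥(W.geomPrimaryTorsion 2), (g : absoluteGaloisGroup ℚ) • a - a =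
            AddSubgroup.inclusion (geomTorsion_le_geomPrimaryTorsion W 2) t) ↔ (t = 0 ∨ t = Tw)) ∧
      (Set.Finite {s : W.selmerInfty κ | 2 • s = 0} ↔
        Set.Finite {y : subgroupH1 κ.kerSubgroup ↥(W.geomTorsion 2) |
          (∀ (u : HeightOneSpectrum (𝓞 ℚ)), ((2 : ℕ) : 𝓞 ℚ) ∉ u.asIdeal → ∀ σ : absoluteGaloisGroup ℚ,
              resOfLe (↥(W.geomTorsion 2)) (inf_le_left : κ.kerSubgroup ⊓ decomp u ≤ κ.kerSubgroup)
                (conjH1 κ.kerSubgroup (↥(W.geomTorsion 2)) σ y) = 0) ∧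
            (∀ σ : absoluteGaloisGroup ℚ,
              conjH1 κ.kerSubgroup (↥(W.geomTorsion ((2 : ℕ) : ℤ))) σ y ∈ N.greenbergKer κ.kerSubgroup) ∧
            ∀ σ : absoluteGaloisGroup ℚ,
              evalH1 htriv g (resOfLe (↥(W.geomTorsion 2)) (inf_le_left : κ.kerSubgroup ⊓ decompInf w ≤ κ.kerSubgroup)
                  (conjH1 κ.kerSubgroup (↥(W.geomTorsion 2)) σ y)) = 0 ∨
                evalH1 htriv g (resOfLe (↥(W.geomTorsion 2)) (inf_le_left : κ.kerSubgroup ⊓ decompInf w ≤ κ.kerSubgroup)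
                  (conjH1 κ.kerSubgroup (↥(W.geomTorsion 2)) σ y)) = Tw}) := by
  obtain ⟨Tw, hTw0, hline, hiff⟩ :=
    RealKummerClassical.exists_kummerLetter_finite_twoTorsion_selmerInfty_iff W κ hκ hΔpos w htriv hg
  refine ⟨Tw, hTw0, hline, hiff.trans (iff_of_eq (congrArg Set.Finite (Set.ext fun y ↦ ?_)))⟩
  simp only [Set.mem_setOf_eq]
  refine and_congr Iff.rfl (and_congr ⟨fun h σ ↦ ?_, fun h u hu σ ↦ ?_⟩ Iff.rfl)
  · exact (torsionToPrimaryH1Sub_mem_localKerOver_iff_of_GV W κ hGV hκ hpv hΔ hord N hN _).1 (h v hpv σ)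
  · -- there is one place above `2`: `u = v`
    have huv : u = v := Literature.NumberTheory.EllipticCurves.HeightOneSpectrum.eq_of_natCast_mem_rat Nat.prime_two hu hpv
    subst huv
    exact (torsionToPrimaryH1Sub_mem_localKerOver_iff_of_GV W κ hGV hκ hu hΔ hord N hN _).2 (h σ)

end RatTwo

end Summit.BirchSwinnertonDyer.BirchSwinnertonDyer.Theorems.AlignedTransportAtTwoFineRoad.RealKummerOrdinary

end
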